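import Literature.NumberTheory.Transcendental.CurvePeriodsEllipticFormsProofs
import Literature.NumberTheory.Transcendental.CurvePeriodsGmPathsProofs
import Literature.NumberTheory.EllipticCurves.ComplexTorusAddProofs
import Literature.NumberTheory.EllipticCurves.WeierstrassTorsion
import HarnessLib

/-!
# Periods of curve type on an elliptic curve, I: the uniformisation and segment symbols

Companion of `Literature/NumberTheory/Transcendental/CurvePeriods.lean` (Huber–Wüstholz 2022,
Thm. 13.3 (2), rendered on explicit period symbols `(Z, ω, γ)` with the elementary relations
(R1)–(R5)) and of `CurvePeriodsEllipticFormsProofs.lean` (the affine Weierstrass curve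
`E_{A,B} = weierCurve A B : y² = x³ + Ax + B`, its invariant differential `θ₀ = dx/y` as a
polynomial form, and the reduction of every form over `ℚ̄` to `a θ₀ + b xθ₀ + dP + ν`).

This file starts the ANALYTIC half of the genus-one case of Theorem 13.3 (2) (book §13.2,
"elliptic curves"; Ch. 18 for the periods `ωᵢ`, quasi-periods `ηᵢ`, `exp_E^* (dx/y) = dz`,
`exp_E^*(x dx/y) = ℘ dz = −dζ`): for a period pair `L` (Mathlib `PeriodPair`, lattice
`Λ = ℤω₁ + ℤω₂`, invariants `g₂, g₃`) the curve is

  `E_L = weierCurve (−g₂/4) (−g₃/4) : y² = x³ − (g₂/4) x − g₃/4`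

(the model `PeriodPair.curve` of `Literature/NumberTheory/EllipticCurves/ComplexTorus.lean`), it
is uniformised by `φ(z) = (℘(z), ℘′(z)/2)` (`Ell.phi`; = `PeriodPair.toPoint` off `Λ`), and we
set up the **segment symbols** `(E_L, ω, φ ∘ [a, b])` for complex numbers `a, b` whose closed
segment avoids `Λ` and whose images are algebraic points (`Ell.segPath`):

* `Ell.theta0_phi` — `θ₀(φ(z)) · φ′(z) = 2`, i.e. `φ^* θ₀ = 2 dz` (book §18.1: `exp^* ω = dz`
  for `ω = dX/Y` on `Y² = 4X³ − g₂X − g₃`; here `y = Y/2`);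
* `Ell.period_theta0_segPath`, `Ell.period_theta1_segPath` — the periods
  `∫_{φ∘[a,b]} θ₀ = 2(b − a)` and `∫_{φ∘[a,b]} xθ₀ = −2(ζ(b) − ζ(a))` (incomplete integrals of the
  first and second kind; `ζ′ = −℘`, `Literature/NumberTheory/EllipticCurves/WeierstrassZeta.lean`);
  in particular `∫_{φ∘[a, a+ωᵢ]} θ₀ = 2ωᵢ` and `∫_{φ∘[a,a+ωᵢ]} xθ₀ = −2ηᵢ`;
* the relations among segment symbols that the rendering provides:
  `Ell.isElementaryRelation_triangle` — (R5) for the affine triangle `φ(a + s(b−a) + t(c−a))`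
  when the closed triangle `abc` avoids `Λ`: `[a,b] + [b,c] − [a,c] ∼ 0`;
  `Ell.segPath_add_of_mem` — lattice translation does not change the symbol (literally:
  `φ ∘ [a + l, b + l] = φ ∘ [a, b]` for `l ∈ Λ`);
  `Ell.span_seg_add_seg_reverse` — `[a,b] + [b,a] ∼ 0`; `Ell.isElementaryRelation_seg_self` —
  `[a,a] ∼ 0`;
* `Ell.isAlgPt_of_torsion` — torsion points `z ∈ ℚΛ ∖ Λ` are algebraic points of `E_L` when
  `g₂, g₃ ∈ ℚ̄` (`Literature/NumberTheory/EllipticCurves/WeierstrassTorsion.lean`), so that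
  segments between torsion points are symbols.

## Role (roadmap of the genus-one case, seat B)

The target is Theorem 13.3 (2) for combinations supported on `𝟙`, genus-`0` symbols and CLOSED
paths on one non-CM curve `E_L` over `ℚ̄`, from the analytic subgroup theorem at period vectors
(`Literature.NumberTheory.Transcendental.analyticSubgroupTheorem_GaGmE_periods`). The remaining
steps, in separate companion files: the doubling descent `[a,b] ∼ ½ [2a,2b]` (functoriality (R4)
along the multiplication-by-`2` map on `E_L ∖ E_L[2]`); the lifting of an arbitrary `C¹` path on
`E_L` through `φ`; the approximation of a lifted closed path by axis-parallel steps of the grids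
`±(ω₁+ω₂)/3 + 2^{−k}Λ` (whose vertices are torsion, whose edges avoid `Λ` and `½Λ`); and the
endgame (`k`-fold descent to the two basic loops `φ∘[g₀, g₀+ωᵢ]`, periods `2ωᵢ`, `−2ηᵢ`).

## References

* A. Huber, G. Wüstholz, *Transcendence and Linear Relations of 1-Periods*, Cambridge Tracts in
  Mathematics 227, CUP 2022 [HuberWustholz2022]: Thm. 13.3 (2) (p. 121), §13.2 (p. 123),
  §18.1 (p. 160: `exp_E^* ω = dz`, `exp_E^* η = −dζ`, `ωᵢ = ∫_{γᵢ} ω`, `ηᵢ = ∫_{γᵢ} η`).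
* J. H. Silverman, *The Arithmetic of Elliptic Curves*, GTM 106, Prop. VI.3.6 (uniformisation).
-/

noncomputable section

open scoped BigOperators
open scoped PeriodPair
open MvPolynomial Set Complex

namespace Literature.NumberTheory.Transcendental

namespace CurvePeriods

set_option quotPrecheck false in
/-- Membership in the `ℚ̄`-span of the elementary relations, in the format of the conclusion of
`HuberWustholzCurvePeriods`. -/
local notation "InSpan" c:max => ∃ (k : ℕ) (ρ : Fin k → (PeriodSymbol →₀ ℂ)) (a : Fin k → ℂ),
  (∀ l, IsElementaryRelation (ρ l)) ∧ (∀ l, IsAlgebraic ℚ (a l)) ∧ c = ∑ l, a l • ρ l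

namespace Ell

variable (L : PeriodPair)

/-! ### The curve `E_L : y² = x³ − (g₂/4)x − g₃/4` -/

/-- The coefficient `A = −g₂/4` of `E_L : y² = x³ + Ax + B`. [folklore] -/
def A : ℂ := -(L.g₂ / 4)

/-- The coefficient `B = −g₃/4` of `E_L : y² = x³ + Ax + B`. [folklore] -/
def B : ℂ := -(L.g₃ / 4)

/-- `4A³ + 27B² = −(g₂³ − 27g₃²)/16`. [folklore] -/
theorem disc_eq : Weier.disc (A L) (B L) = -(L.g₂ ^ 3 - 27 * L.g₃ ^ 2) / 16 := by
  simp only [Weier.disc, A, B]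
  ring

/-- `4A³ + 27B² ≠ 0` (`Δ(Λ) ≠ 0`, `PeriodPair.discr_ne_zero`). [folklore] -/
theorem disc_ne_zero : Weier.disc (A L) (B L) ≠ 0 := by
  rw [disc_eq]
  exact div_ne_zero (neg_ne_zero.mpr L.discr_ne_zero) (by norm_num)

/-- `A` is algebraic when `g₂` is. [folklore] -/
theorem isAlgebraic_A (h₂ : IsAlgebraic ℚ L.g₂) : IsAlgebraic ℚ (A L) := by
  rw [A, div_eq_mul_inv]
  exact (h₂.mul (isAlgebraic_nat 4).inv).neg

/-- `B` is algebraic when `g₃` is. [folklore] -/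
theorem isAlgebraic_B (h₃ : IsAlgebraic ℚ L.g₃) : IsAlgebraic ℚ (B L) := by
  rw [B, div_eq_mul_inv]
  exact (h₃.mul (isAlgebraic_nat 4).inv).neg

/-- **The affine elliptic curve `E_L = {y² = x³ − (g₂/4)x − g₃/4} ⊂ 𝔸²`** of the period pair `L`
(the curve `E_{A,B}` of `CurvePeriodsEllipticFormsProofs.lean` with `A = −g₂/4`, `B = −g₃/4`;
the model `PeriodPair.curve` of `ComplexTorus.lean`). [cite: HuberWustholz2022, §13.2 (p. 123)] -/
abbrev curve : CurveData := weierCurve (A L) (B L)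

/-- `E_L` is a smooth affine curve over `ℚ̄` when `g₂, g₃ ∈ ℚ̄`. [folklore] -/
theorem smooth (h₂ : IsAlgebraic ℚ L.g₂) (h₃ : IsAlgebraic ℚ L.g₃) :
    (curve L).IsSmoothAffineCurve :=
  Weier.isSmoothAffineCurve (A L) (B L) (isAlgebraic_A L h₂) (isAlgebraic_B L h₃) (disc_ne_zero L)

/-- The invariant differential `θ₀` (polynomial representative of `dx/y`) on `E_L`. [folklore] -/
abbrev theta0 : Fin 2 → MvPolynomial (Fin 2) ℂ := Weier.theta0 (A L) (B L)

/-- The form `θ₁ = x θ₀` (representative of `x dx/y`, the differential of the second kind).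
[folklore] -/
abbrev theta1 : Fin 2 → MvPolynomial (Fin 2) ℂ :=
  (X 0 : MvPolynomial (Fin 2) ℂ) • Weier.theta0 (A L) (B L)

/-- `θ₀` is defined over `ℚ̄`. [folklore] -/
theorem hasAlgCoeffs_theta0 (h₂ : IsAlgebraic ℚ L.g₂) (h₃ : IsAlgebraic ℚ L.g₃) :
    ∀ k, HasAlgCoeffs (theta0 L k) :=
  Weier.hasAlgCoeffs_theta0 (A L) (B L) (isAlgebraic_A L h₂) (isAlgebraic_B L h₃)

/-- `θ₁` is defined over `ℚ̄`. [folklore] -/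
theorem hasAlgCoeffs_theta1 (h₂ : IsAlgebraic ℚ L.g₂) (h₃ : IsAlgebraic ℚ L.g₃) :
    ∀ k, HasAlgCoeffs (theta1 L k) :=
  Weier.hasAlgCoeffs_smul_theta0 (A L) (B L) (isAlgebraic_A L h₂) (isAlgebraic_B L h₃)
    (hasAlgCoeffs_X 0)

/-! ### The uniformisation `φ(z) = (℘(z), ℘′(z)/2)` -/

/-- **The uniformisation** `φ(z) = (℘(z), ℘′(z)/2) ∈ ℂ²` (a point of `E_L` for `z ∉ Λ`).
[cite: HuberWustholz2022, §18.1 (p. 160)] -/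
def phi (z : ℂ) : Fin 2 → ℂ := ![℘[L] z, ℘'[L] z / 2]

/-- The complex velocity `φ′(z) = (℘′(z), ℘″(z)/2) = (℘′(z), 3℘(z)² − g₂/4)`. [folklore] -/
def phiD (z : ℂ) : Fin 2 → ℂ := ![℘'[L] z, 3 * ℘[L] z ^ 2 - L.g₂ / 4]

/-- First coordinate of `φ`. [folklore] -/
@[simp] theorem phi_apply_zero (z : ℂ) : phi L z 0 = ℘[L] z := rfl

/-- Second coordinate of `φ`. [folklore] -/
@[simp] theorem phi_apply_one (z : ℂ) : phi L z 1 = ℘'[L] z / 2 := rfl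

/-- First coordinate of `φ′`. [folklore] -/
@[simp] theorem phiD_apply_zero (z : ℂ) : phiD L z 0 = ℘'[L] z := rfl

/-- Second coordinate of `φ′`. [folklore] -/
@[simp] theorem phiD_apply_one (z : ℂ) : phiD L z 1 = 3 * ℘[L] z ^ 2 - L.g₂ / 4 := rfl

/-- `f(℘(z)) = ℘(z)³ + A℘(z) + B`, the cubic of `E_L` at `x = ℘(z)`. [folklore] -/
theorem eval_fPoly_phi (z : ℂ) :
    eval (phi L z) (Weier.fPoly (A L) (B L)) = ℘[L] z ^ 3 + A L * ℘[L] z + B L := by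
  rw [Weier.eval_fPoly]
  rfl

/-- `φ(z) ∈ E_L` for `z ∉ Λ` (`℘′² = 4℘³ − g₂℘ − g₃`). [cite: HuberWustholz2022, §18.1 (p. 160)] -/
theorem phi_mem_points {z : ℂ} (hz : z ∉ L.lattice) : phi L z ∈ (curve L).points := by
  rw [Weier.mem_points_iff, Weier.eval_fPoly]
  simp only [phi, A, B, Matrix.cons_val_one, Matrix.cons_val_zero]
  linear_combination (1 / 4 : ℂ) * L.derivWeierstrassP_sq z hz

/-- `φ` is `Λ`-periodic. [folklore] -/
theorem phi_add_of_mem (z : ℂ) {l : ℂ} (hl : l ∈ L.lattice) : phi L (z + l) = phi L z := by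
  have h1 := L.weierstrassP_add_coe z ⟨l, hl⟩
  have h2 := L.derivWeierstrassP_add_coe z ⟨l, hl⟩
  simp only at h1 h2
  funext k
  fin_cases k
  · simpa [phi] using h1
  · simp [phi, h2]

/-- `φ(−z) = (℘(z), −℘′(z)/2)`. [folklore] -/
theorem phi_neg (z : ℂ) : phi L (-z) = ![℘[L] z, -(℘'[L] z / 2)] := by
  funext k
  fin_cases k
  · simp [phi, L.weierstrassP_neg]
  · simp [phi, L.derivWeierstrassP_neg, neg_div]

/-- `φ` has complex derivative `φ′ = phiD` off the lattice (`℘′`, and `℘″ = 6℘² − g₂/2`).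
[folklore] -/
theorem hasDerivAt_phi {z : ℂ} (hz : z ∉ L.lattice) :
    ∀ k : Fin 2, HasDerivAt (fun w => phi L w k) (phiD L z k) z := by
  rw [Fin.forall_fin_two]
  refine ⟨?_, ?_⟩
  · simpa [phi, phiD] using PeriodPair.hasDerivAt_weierstrassP (L := L) hz
  · have h := (L.hasDerivAt_derivWeierstrassP hz).div_const 2
    have e : (6 * ℘[L] z ^ 2 - L.g₂ / 2) / 2 = 3 * ℘[L] z ^ 2 - L.g₂ / 4 := by ring
    rw [e] at h
    simpa [phi, phiD] using h

/-- Derivative of `s ↦ φ(a + s v)` along a real parameter. [folklore] -/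
theorem hasDerivAt_phi_line (a v : ℂ) {t : ℝ} (h : a + t * v ∉ L.lattice) (k : Fin 2) :
    HasDerivAt (fun s : ℝ => phi L (a + s * v) k) (phiD L (a + t * v) k * v) t := by
  have hin : HasDerivAt (fun s : ℂ => a + s * v) v (t : ℂ) := by
    simpa using ((hasDerivAt_id (t : ℂ)).mul_const v).const_add a
  have h2 := (hasDerivAt_phi L h k).comp (t : ℂ) hin
  exact h2.comp_ofReal

/-- **`φ^* θ₀ = 2 dz`**: `θ₀(φ(z)) · φ′(z) = 2` for `z ∉ Λ`. With `θ₀ = (1/D)(−U y dx + 2V dy)`,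
`y = ℘′/2`, `dx(φ′) = ℘′`, `dy(φ′) = ℘″/2 = f′(℘)`: the value is `(2/D)(V f′ − U f)(℘) = 2` by the
Bézout identity and `℘′² = 4 f(℘)`. (Book §18.1: `exp_E^* (dX/Y) = dz`; here `y = Y/2`.)
[cite: HuberWustholz2022, §18.1 (p. 160)] -/
theorem theta0_phi {z : ℂ} (hz : z ∉ L.lattice) :
    ∑ k, eval (phi L z) (theta0 L k) * phiD L z k = 2 := by
  have hb := Weier.eval_bezout (A L) (B L) (phi L z)
  rw [Weier.eval_pderiv_zero_fPoly, eval_fPoly_phi] at hb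
  simp only [phi_apply_zero] at hb
  have hsq := L.derivWeierstrassP_sq z hz
  have hD := disc_ne_zero L
  have hg₂ : L.g₂ = -4 * A L := by rw [A]; ring
  have hg₃ : L.g₃ = -4 * B L := by rw [B]; ring
  rw [hg₂, hg₃] at hsq
  simp only [Weier.theta0, Fin.sum_univ_two, Matrix.cons_val_zero, Matrix.cons_val_one, map_mul,
    eval_C, eval_X, phi_apply_one, phiD_apply_zero, phiD_apply_one]
  rw [hg₂]
  field_simp
  linear_combination (4 : ℂ) * hb - (eval (phi L z) (Weier.uPol (A L) (B L))) * hsq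

/-- **`φ^* θ₁ = 2℘ dz`**: `θ₁(φ(z)) · φ′(z) = 2℘(z)` for `z ∉ Λ` (book §18.1: `exp_E^*(X dX/Y) = ℘ dz`).
[cite: HuberWustholz2022, §18.1 (p. 160)] -/
theorem theta1_phi {z : ℂ} (hz : z ∉ L.lattice) :
    ∑ k, eval (phi L z) (theta1 L k) * phiD L z k = 2 * ℘[L] z := by
  have h := theta0_phi L hz
  rw [Fin.sum_univ_two] at h ⊢
  simp only [theta1, Pi.smul_apply, smul_eq_mul, map_mul, eval_X, phi_apply_zero] at h ⊢
  linear_combination ℘[L] z * h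

/-- `φ′(z)` is tangent to `E_L` at `φ(z)` (`−f′(x) · ℘′ + 2y · f′(x) = 0` with `y = ℘′/2`).
[folklore] -/
theorem phiD_mem_tangentSpace (z : ℂ) : phiD L z ∈ (curve L).tangentSpace (phi L z) := by
  rw [Weier.mem_tangentSpace_iff, Weier.eval_pderiv_zero_fPoly]
  simp only [phi_apply_zero, phi_apply_one, phiD_apply_zero, phiD_apply_one, A]
  ring

/-! ### Algebraic points -/

/-- `z` is (the logarithm of) an **algebraic point** of `E_L`: `z ∉ Λ` and `℘(z), ℘′(z)/2 ∈ ℚ̄`.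
[folklore] -/
def IsAlgPt (z : ℂ) : Prop := z ∉ L.lattice ∧ ∀ k, IsAlgebraic ℚ (phi L z k)

variable {L}

/-- An algebraic point is off the lattice. [folklore] -/
theorem IsAlgPt.notMem {z : ℂ} (h : IsAlgPt L z) : z ∉ L.lattice := h.1

/-- The coordinates of an algebraic point are algebraic. [folklore] -/
theorem IsAlgPt.isAlgebraic {z : ℂ} (h : IsAlgPt L z) (k : Fin 2) : IsAlgebraic ℚ (phi L z k) :=
  h.2 k

/-- `℘(z) ∈ ℚ̄` at an algebraic point. [folklore] -/
theorem IsAlgPt.weierstrassP {z : ℂ} (h : IsAlgPt L z) : IsAlgebraic ℚ (℘[L] z) := h.2 0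

/-- `℘′(z) ∈ ℚ̄` at an algebraic point. [folklore] -/
theorem IsAlgPt.derivWeierstrassP {z : ℂ} (h : IsAlgPt L z) : IsAlgebraic ℚ (℘'[L] z) := by
  have h1 := h.2 1
  simp only [phi_apply_one] at h1
  have : ℘'[L] z = ℘'[L] z / 2 * 2 := by ring
  rw [this]
  exact h1.mul (isAlgebraic_nat 2)

variable (L) in
/-- A point with `℘(z), ℘′(z) ∈ ℚ̄` is an algebraic point. [folklore] -/
theorem isAlgPt_of_isAlgebraic {z : ℂ} (hz : z ∉ L.lattice) (h℘ : IsAlgebraic ℚ (℘[L] z))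
    (h℘' : IsAlgebraic ℚ (℘'[L] z)) : IsAlgPt L z := by
  refine ⟨hz, fun k => ?_⟩
  fin_cases k
  · simpa using h℘
  · simpa [div_eq_mul_inv] using h℘'.mul (isAlgebraic_nat 2).inv

/-- Algebraic points are stable under lattice translation. [folklore] -/
theorem IsAlgPt.add_of_mem {z l : ℂ} (h : IsAlgPt L z) (hl : l ∈ L.lattice) : IsAlgPt L (z + l) := by
  refine ⟨fun h' => h.1 (by simpa using sub_mem h' hl), fun k => ?_⟩
  rw [phi_add_of_mem L z hl]
  exact h.2 k

/-- Algebraic points are stable under `z ↦ −z`. [folklore] -/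
theorem IsAlgPt.neg {z : ℂ} (h : IsAlgPt L z) : IsAlgPt L (-z) := by
  refine ⟨fun h' => h.1 (by simpa using neg_mem h'), fun k => ?_⟩
  rw [phi_neg]
  fin_cases k
  · simpa using h.2 0
  · simpa using (h.2 1).neg

variable (L) in
/-- **Torsion points are algebraic points** (for `g₂, g₃ ∈ ℚ̄`): if `z ∉ Λ` and `m z ∈ Λ` for some
`m ≥ 1` then `℘(z), ℘′(z) ∈ ℚ̄` (`WeierstrassTorsion.lean`). [folklore] -/
theorem isAlgPt_of_torsion (h₂ : IsAlgebraic ℚ L.g₂) (h₃ : IsAlgebraic ℚ L.g₃) {z : ℂ}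
    (hz : z ∉ L.lattice) {m : ℕ} (hm : 0 < m) (hmz : (m : ℂ) * z ∈ L.lattice) : IsAlgPt L z :=
  isAlgPt_of_isAlgebraic L hz (L.isAlgebraic_weierstrassP_of_torsion h₂ h₃ hz hm hmz)
    (L.isAlgebraic_derivWeierstrassP_of_torsion h₂ h₃ hz hm hmz)

/-! ### Segment paths `φ ∘ [a, b]` -/

variable (L)

/-- The parametrisation `t ↦ φ(a + t(b − a))` of the image of the segment `[a, b]`. [folklore] -/
def segFun (a b : ℂ) (t : ℝ) : Fin 2 → ℂ := phi L (a + t * (b - a))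

/-- `segFun` unfolded. [folklore] -/
theorem segFun_apply (a b : ℂ) (t : ℝ) : segFun L a b t = phi L (a + t * (b - a)) := rfl

/-- The segment path starts at `φ(a)`. [folklore] -/
@[simp] theorem segFun_zero (a b : ℂ) : segFun L a b 0 = phi L a := by
  simp [segFun]

/-- The segment path ends at `φ(b)`. [folklore] -/
@[simp] theorem segFun_one (a b : ℂ) : segFun L a b 1 = phi L b := by
  simp [segFun]

/-- The real-affine map `t ↦ a + t v` is smooth. [folklore] -/
theorem contDiff_line (a v : ℂ) : ContDiff ℝ ⊤ fun t : ℝ => a + (t : ℂ) * v :=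
  contDiff_const.add (ofRealCLM.contDiff.mul contDiff_const)

/-- `φ` is real-`C¹` (indeed holomorphic) off the lattice, componentwise. [folklore] -/
theorem contDiffOn_phi (k : Fin 2) : ContDiffOn ℝ 1 (fun w => phi L w k) (L.lattice : Set ℂ)ᶜ := by
  have hopen : IsOpen ((L.lattice : Set ℂ)ᶜ) := L.isClosed_lattice.isOpen_compl
  fin_cases k
  · have h := (L.differentiableOn_weierstrassP.contDiffOn (n := 1) hopen).restrict_scalars ℝ
    simpa [phi] using h
  · have h := ((L.differentiableOn_derivWeierstrassP.div_const 2).contDiffOn (n := 1)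
      hopen).restrict_scalars ℝ
    simpa [phi] using h

/-- `segFun` is `C¹` on `[0,1]` when the closed segment avoids `Λ`. [folklore] -/
theorem contDiffOn_segFun {a b : ℂ} (hab : ∀ t ∈ Icc (0 : ℝ) 1, a + t * (b - a) ∉ L.lattice) :
    ContDiffOn ℝ 1 (segFun L a b) (Icc 0 1) := by
  refine contDiffOn_pi.2 fun k => ?_
  have h := (contDiffOn_phi L k).comp ((contDiff_line a (b - a)).of_le le_top).contDiffOn
    (fun t ht => hab t ht)
  simpa [segFun, Function.comp_def] using h

variable {L}

/-- **The segment path `φ ∘ [a, b]`** on `E_L`, for a closed segment `[a, b] ⊂ ℂ ∖ Λ` with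
algebraic end points `φ(a), φ(b)`. [cite: HuberWustholz2022, §18.1 (p. 160)] -/
def segPath {a b : ℂ} (hab : ∀ t ∈ Icc (0 : ℝ) 1, a + t * (b - a) ∉ L.lattice)
    (ha : IsAlgPt L a) (hb : IsAlgPt L b) : CurvePath (curve L) where
  toFun := segFun L a b
  contDiffOn := contDiffOn_segFun L hab
  mem_points t ht := phi_mem_points L (hab t ht)
  algebraic_zero k := by simpa using ha.2 k
  algebraic_one k := by simpa using hb.2 k

/-- The parametrisation of `segPath`. [folklore] -/
@[simp] theorem segPath_toFun {a b : ℂ} (hab : ∀ t ∈ Icc (0 : ℝ) 1, a + t * (b - a) ∉ L.lattice)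
    (ha : IsAlgPt L a) (hb : IsAlgPt L b) (t : ℝ) :
    (segPath hab ha hb).toFun t = phi L (a + t * (b - a)) := rfl

/-- A degenerate segment `[a, a]` avoids `Λ` when `a ∉ Λ`. [folklore] -/
theorem seg_self_notMem {a : ℂ} (ha : a ∉ L.lattice) :
    ∀ t ∈ Icc (0 : ℝ) 1, a + t * (a - a) ∉ L.lattice := fun t _ => by
  simpa using ha

/-- The reversed segment avoids `Λ` when the segment does. [folklore] -/
theorem seg_reverse_notMem {a b : ℂ} (hab : ∀ t ∈ Icc (0 : ℝ) 1, a + t * (b - a) ∉ L.lattice) :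
    ∀ t ∈ Icc (0 : ℝ) 1, b + t * (a - b) ∉ L.lattice := fun t ht => by
  have h := hab (1 - t) ⟨by linarith [ht.2], by linarith [ht.1]⟩
  have e : a + ((1 - t : ℝ) : ℂ) * (b - a) = b + (t : ℂ) * (a - b) := by push_cast; ring
  rwa [e] at h

/-- A translated segment avoids `Λ` when the segment does (`l ∈ Λ`). [folklore] -/
theorem seg_add_notMem {a b l : ℂ} (hl : l ∈ L.lattice)
    (hab : ∀ t ∈ Icc (0 : ℝ) 1, a + t * (b - a) ∉ L.lattice) :
    ∀ t ∈ Icc (0 : ℝ) 1, a + l + t * (b + l - (a + l)) ∉ L.lattice := fun t ht h => by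
  apply hab t ht
  have e : a + l + (t : ℂ) * (b + l - (a + l)) = a + (t : ℂ) * (b - a) + l := by ring
  rw [e] at h
  simpa using sub_mem h hl

/-- **Lattice translation does not change the segment path**: `φ ∘ [a + l, b + l] = φ ∘ [a, b]`
for `l ∈ Λ` (literally the same `C¹` path, `φ` being `Λ`-periodic). [folklore] -/
theorem segPath_add_of_mem {a b l : ℂ} (hl : l ∈ L.lattice)
    (hab : ∀ t ∈ Icc (0 : ℝ) 1, a + t * (b - a) ∉ L.lattice)
    (hab' : ∀ t ∈ Icc (0 : ℝ) 1, a + l + t * (b + l - (a + l)) ∉ L.lattice)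
    (ha : IsAlgPt L a) (hb : IsAlgPt L b) (ha' : IsAlgPt L (a + l)) (hb' : IsAlgPt L (b + l)) :
    segPath hab' ha' hb' = segPath hab ha hb := by
  refine CurvePath.eq_of_toFun_eq fun t => ?_
  simp only [segPath_toFun]
  have e : a + l + (t : ℂ) * (b + l - (a + l)) = a + (t : ℂ) * (b - a) + l := by ring
  rw [e, phi_add_of_mem L _ hl]

/-! ### Periods of segment symbols -/

section Periods

variable (h₂ : IsAlgebraic ℚ L.g₂) (h₃ : IsAlgebraic ℚ L.g₃)
include h₂ h₃

/-- **`∫_{φ∘[a,b]} θ₀ = 2(b − a)`** (incomplete elliptic integral of the first kind: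
`φ^*θ₀ = 2dz`). [cite: HuberWustholz2022, §18.1 (p. 160)] -/
theorem period_theta0_segPath {a b : ℂ} (hab : ∀ t ∈ Icc (0 : ℝ) 1, a + t * (b - a) ∉ L.lattice)
    (ha : IsAlgPt L a) (hb : IsAlgPt L b) :
    (⟨curve L, smooth L h₂ h₃, theta0 L, hasAlgCoeffs_theta0 L h₂ h₃, segPath hab ha hb⟩ :
      PeriodSymbol).period = 2 * (b - a) := by
  rw [PeriodSymbol.period_eq_of_hasDerivAt
    ⟨curve L, smooth L h₂ h₃, theta0 L, hasAlgCoeffs_theta0 L h₂ h₃, segPath hab ha hb⟩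
    (segFun L a b) (fun t k => phiD L (a + t * (b - a)) k * (b - a)) (fun t _ => rfl)
    (fun t ht k => hasDerivAt_phi_line L a (b - a) (hab t (Ioo_subset_Icc_self ht)) k)]
  have hconst : ∀ t ∈ Icc (0 : ℝ) 1, (∑ k : Fin 2, eval (segFun L a b t) (theta0 L k) *
      (phiD L (a + t * (b - a)) k * (b - a))) = 2 * (b - a) := fun t ht => by
    have h := theta0_phi L (hab t ht)
    rw [Fin.sum_univ_two] at h ⊢
    simp only [segFun_apply]
    linear_combination (b - a) * h
  rw [intervalIntegral.integral_congr (g := fun _ => 2 * (b - a))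
    (fun t ht => hconst t (by rwa [uIcc_of_le zero_le_one] at ht))]
  simp

/-- **`∫_{φ∘[a,b]} θ₁ = −2(ζ(b) − ζ(a))`** (incomplete elliptic integral of the second kind:
`φ^*(xθ₀) = 2℘ dz = −2 dζ`). [cite: HuberWustholz2022, §18.1 (p. 160)] -/
theorem period_theta1_segPath {a b : ℂ} (hab : ∀ t ∈ Icc (0 : ℝ) 1, a + t * (b - a) ∉ L.lattice)
    (ha : IsAlgPt L a) (hb : IsAlgPt L b) :
    (⟨curve L, smooth L h₂ h₃, theta1 L, hasAlgCoeffs_theta1 L h₂ h₃, segPath hab ha hb⟩ :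
      PeriodSymbol).period = -2 * (L.weierstrassZeta b - L.weierstrassZeta a) := by
  rw [PeriodSymbol.period_eq_of_hasDerivAt
    ⟨curve L, smooth L h₂ h₃, theta1 L, hasAlgCoeffs_theta1 L h₂ h₃, segPath hab ha hb⟩
    (segFun L a b) (fun t k => phiD L (a + t * (b - a)) k * (b - a)) (fun t _ => rfl)
    (fun t ht k => hasDerivAt_phi_line L a (b - a) (hab t (Ioo_subset_Icc_self ht)) k)]
  -- the integrand is `2 ℘(a + t(b − a)) (b − a)`, the derivative of `−2 ζ(a + t(b − a))`
  have hF : ∀ t ∈ Icc (0 : ℝ) 1, (∑ k : Fin 2, eval (segFun L a b t) (theta1 L k) *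
      (phiD L (a + t * (b - a)) k * (b - a))) = 2 * ℘[L] (a + t * (b - a)) * (b - a) :=
    fun t ht => by
    have h := theta1_phi L (hab t ht)
    rw [Fin.sum_univ_two] at h ⊢
    simp only [segFun_apply]
    linear_combination (b - a) * h
  -- `ζ' = −℘` off the lattice (`WeierstrassZeta.lean`; cf. `PeriodPair.hasDerivAt_weierstrassZeta`
  -- in `SigmaJets.lean`, not imported here)
  have hζ : ∀ z, z ∉ L.lattice → HasDerivAt L.weierstrassZeta (-℘[L] z) z := fun z hz => by
    have hd : DifferentiableAt ℂ L.weierstrassZeta z :=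
      L.differentiableOn_weierstrassZeta_holds.differentiableAt
        (L.isClosed_lattice.isOpen_compl.mem_nhds hz)
    rw [← L.deriv_weierstrassZeta_holds z hz]
    exact hd.hasDerivAt
  have hderiv : ∀ t ∈ uIcc (0 : ℝ) 1, HasDerivAt (fun s : ℝ => -2 * L.weierstrassZeta (a + s * (b - a)))
      (2 * ℘[L] (a + t * (b - a)) * (b - a)) t := fun t ht => by
    rw [uIcc_of_le zero_le_one] at ht
    have hin : HasDerivAt (fun s : ℂ => a + s * (b - a)) (b - a) (t : ℂ) := by
      simpa using ((hasDerivAt_id (t : ℂ)).mul_const (b - a)).const_add a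
    have h1 := ((hζ _ (hab t ht)).comp (t : ℂ) hin).comp_ofReal
    have h2 := h1.const_mul (-2)
    refine h2.congr_deriv ?_
    ring
  have hcont : ContinuousOn (fun t : ℝ => 2 * ℘[L] (a + t * (b - a)) * (b - a)) (Icc 0 1) := by
    refine (continuousOn_const.mul ?_).mul continuousOn_const
    have h := (contDiffOn_segFun L hab).continuousOn
    have h0 := (continuous_apply (0 : Fin 2)).comp_continuousOn h
    simpa [segFun, Function.comp_def] using h0
  have hint : IntervalIntegrable (fun t : ℝ => 2 * ℘[L] (a + t * (b - a)) * (b - a))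
      MeasureTheory.volume 0 1 :=
    (hcont.mono (by rw [uIcc_of_le zero_le_one])).intervalIntegrable
  rw [intervalIntegral.integral_congr (fun t ht => hF t (by rwa [uIcc_of_le zero_le_one] at ht)),
    intervalIntegral.integral_eq_sub_of_hasDerivAt hderiv hint]
  simp only [ofReal_one, one_mul, ofReal_zero, zero_mul, add_zero, add_sub_cancel]
  ring

/-- **The basic loops**: `∫_{φ∘[a, a+ω₁]} θ₀ = 2ω₁`. [cite: HuberWustholz2022, §18.1 (p. 160)] -/
theorem period_theta0_segPath_ω₁ {a : ℂ} (h : ∀ t ∈ Icc (0 : ℝ) 1, a + t * (a + L.ω₁ - a) ∉ L.lattice)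
    (ha : IsAlgPt L a) (ha' : IsAlgPt L (a + L.ω₁)) :
    (⟨curve L, smooth L h₂ h₃, theta0 L, hasAlgCoeffs_theta0 L h₂ h₃, segPath h ha ha'⟩ :
      PeriodSymbol).period = 2 * L.ω₁ := by
  rw [period_theta0_segPath h₂ h₃ h ha ha']
  ring

/-- `∫_{φ∘[a, a+ω₂]} θ₀ = 2ω₂`. [cite: HuberWustholz2022, §18.1 (p. 160)] -/
theorem period_theta0_segPath_ω₂ {a : ℂ} (h : ∀ t ∈ Icc (0 : ℝ) 1, a + t * (a + L.ω₂ - a) ∉ L.lattice)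
    (ha : IsAlgPt L a) (ha' : IsAlgPt L (a + L.ω₂)) :
    (⟨curve L, smooth L h₂ h₃, theta0 L, hasAlgCoeffs_theta0 L h₂ h₃, segPath h ha ha'⟩ :
      PeriodSymbol).period = 2 * L.ω₂ := by
  rw [period_theta0_segPath h₂ h₃ h ha ha']
  ring

/-- `∫_{φ∘[a, a+ω₁]} θ₁ = −2η₁` (quasi-periodicity `ζ(z + ω₁) = ζ(z) + η₁`).
[cite: HuberWustholz2022, §18.1 (p. 160)] -/
theorem period_theta1_segPath_ω₁ {a : ℂ} (h : ∀ t ∈ Icc (0 : ℝ) 1, a + t * (a + L.ω₁ - a) ∉ L.lattice)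
    (ha : IsAlgPt L a) (ha' : IsAlgPt L (a + L.ω₁)) :
    (⟨curve L, smooth L h₂ h₃, theta1 L, hasAlgCoeffs_theta1 L h₂ h₃, segPath h ha ha'⟩ :
      PeriodSymbol).period = -2 * L.η₁ := by
  rw [period_theta1_segPath h₂ h₃ h ha ha']
  have hq := L.weierstrassZeta_add_int_mul_ω₁ 1 a
  simp only [Int.cast_one, one_mul] at hq
  rw [hq]
  ring

/-- `∫_{φ∘[a, a+ω₂]} θ₁ = −2η₂`. [cite: HuberWustholz2022, §18.1 (p. 160)] -/
theorem period_theta1_segPath_ω₂ {a : ℂ} (h : ∀ t ∈ Icc (0 : ℝ) 1, a + t * (a + L.ω₂ - a) ∉ L.lattice)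
    (ha : IsAlgPt L a) (ha' : IsAlgPt L (a + L.ω₂)) :
    (⟨curve L, smooth L h₂ h₃, theta1 L, hasAlgCoeffs_theta1 L h₂ h₃, segPath h ha ha'⟩ :
      PeriodSymbol).period = -2 * L.η₂ := by
  rw [period_theta1_segPath h₂ h₃ h ha ha']
  have hq := L.weierstrassZeta_add_int_mul_ω₂ 1 a
  simp only [Int.cast_one, one_mul] at hq
  rw [hq]
  ring

end Periods

/-! ### Relations among segment symbols -/

/-- The first two barycentric coordinates of a point of the standard triangle give a point of the
affine triangle `a + s(b − a) + t(c − a)`; its three edges. [folklore] -/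
theorem triangle_edge₀₁ (a b c : ℂ) (t : ℝ) :
    a + ((t, (0 : ℝ)) : ℝ × ℝ).1 * (b - a) + ((t, (0 : ℝ)) : ℝ × ℝ).2 * (c - a) = a + t * (b - a) := by
  simp

/-- The edge `v₁v₂` of the affine triangle is the segment `[b, c]`. [folklore] -/
theorem triangle_edge₁₂ (a b c : ℂ) (t : ℝ) :
    a + ((1 - t, t) : ℝ × ℝ).1 * (b - a) + ((1 - t, t) : ℝ × ℝ).2 * (c - a) = b + t * (c - b) := by
  simp only [ofReal_sub, ofReal_one]
  ring

/-- The edge `v₀v₂` of the affine triangle is the segment `[a, c]`. [folklore] -/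
theorem triangle_edge₀₂ (a b c : ℂ) (t : ℝ) :
    a + (((0 : ℝ), t) : ℝ × ℝ).1 * (b - a) + (((0 : ℝ), t) : ℝ × ℝ).2 * (c - a) = a + t * (c - a) := by
  simp

/-- **(R5) for affine triangles avoiding `Λ`**: if the closed triangle with vertices `a, b, c`
(algebraic points) avoids `Λ`, then `(E_L, ω, φ∘[a,b]) + (E_L, ω, φ∘[b,c]) − (E_L, ω, φ∘[a,c])` is
an elementary relation, for every form `ω` over `ℚ̄` — the boundary of the `C¹` (indeed
holomorphic) triangle `φ(a + s(b − a) + t(c − a))`. [cite: HuberWustholz2022, §3.3.1 (p. 42)] -/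
theorem isElementaryRelation_triangle (hE : (curve L).IsSmoothAffineCurve)
    (ω : Fin 2 → MvPolynomial (Fin 2) ℂ) (hω : ∀ k, HasAlgCoeffs (ω k)) {a b c : ℂ}
    (hab : ∀ t ∈ Icc (0 : ℝ) 1, a + t * (b - a) ∉ L.lattice)
    (hbc : ∀ t ∈ Icc (0 : ℝ) 1, b + t * (c - b) ∉ L.lattice)
    (hac : ∀ t ∈ Icc (0 : ℝ) 1, a + t * (c - a) ∉ L.lattice)
    (ha : IsAlgPt L a) (hb : IsAlgPt L b) (hc : IsAlgPt L c)
    (habc : ∀ p ∈ stdTriangle, a + p.1 * (b - a) + p.2 * (c - a) ∉ L.lattice) :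
    IsElementaryRelation
      (Finsupp.single (⟨curve L, hE, ω, hω, segPath hab ha hb⟩ : PeriodSymbol) 1 +
        Finsupp.single (⟨curve L, hE, ω, hω, segPath hbc hb hc⟩ : PeriodSymbol) 1 -
        Finsupp.single (⟨curve L, hE, ω, hω, segPath hac ha hc⟩ : PeriodSymbol) 1) := by
  -- the triangle `τ(s, t) = φ(a + s(b − a) + t(c − a))`
  have hg : ContDiff ℝ ⊤ fun p : ℝ × ℝ => a + (p.1 : ℂ) * (b - a) + (p.2 : ℂ) * (c - a) :=
    (contDiff_const.add ((ofRealCLM.contDiff.comp contDiff_fst).mul contDiff_const)).add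
      ((ofRealCLM.contDiff.comp contDiff_snd).mul contDiff_const)
  have hτ : ContDiffOn ℝ 1 (fun p : ℝ × ℝ => phi L (a + (p.1 : ℂ) * (b - a) + (p.2 : ℂ) * (c - a)))
      stdTriangle := by
    refine contDiffOn_pi.2 fun k => ?_
    have h := (contDiffOn_phi L k).comp (hg.of_le le_top).contDiffOn (fun p hp => habc p hp)
    simpa [Function.comp_def] using h
  have hτZ : MapsTo (fun p : ℝ × ℝ => phi L (a + (p.1 : ℂ) * (b - a) + (p.2 : ℂ) * (c - a)))
      stdTriangle (curve L).points := fun p hp => phi_mem_points L (habc p hp)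
  refine IsElementaryRelation.boundary (curve L) hE ω hω _ hτ hτZ (segPath hab ha hb)
    (segPath hbc hb hc) (segPath hac ha hc) (fun t _ => ?_) (fun t _ => ?_) (fun t _ => ?_)
  · rw [segPath_toFun, triangle_edge₀₁]
  · rw [segPath_toFun, triangle_edge₁₂]
  · rw [segPath_toFun, triangle_edge₀₂]

/-- **`[a, a] ∼ 0`**: the symbol of a constant segment is an elementary relation. [folklore] -/
theorem isElementaryRelation_seg_self (hE : (curve L).IsSmoothAffineCurve)
    (ω : Fin 2 → MvPolynomial (Fin 2) ℂ) (hω : ∀ k, HasAlgCoeffs (ω k)) {a : ℂ}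
    (haa : ∀ t ∈ Icc (0 : ℝ) 1, a + t * (a - a) ∉ L.lattice) (ha : IsAlgPt L a) :
    IsElementaryRelation
      (Finsupp.single (⟨curve L, hE, ω, hω, segPath haa ha ha⟩ : PeriodSymbol) 1) :=
  isElementaryRelation_single_of_const hE ω hω (segPath haa ha ha) (phi L a) fun t _ => by
    simp [segPath_toFun]

/-- **Reversal `[a, b] + [b, a] ∼ 0`**: the sum of the symbols of a segment and of the reversed
segment lies in the span of the elementary relations. [cite: HuberWustholz2022, §3.3.1 (p. 42)] -/
theorem span_seg_add_seg_reverse (hE : (curve L).IsSmoothAffineCurve)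
    (ω : Fin 2 → MvPolynomial (Fin 2) ℂ) (hω : ∀ k, HasAlgCoeffs (ω k)) {a b : ℂ}
    (hab : ∀ t ∈ Icc (0 : ℝ) 1, a + t * (b - a) ∉ L.lattice)
    (hba : ∀ t ∈ Icc (0 : ℝ) 1, b + t * (a - b) ∉ L.lattice)
    (ha : IsAlgPt L a) (hb : IsAlgPt L b) :
    InSpan (Finsupp.single (⟨curve L, hE, ω, hω, segPath hab ha hb⟩ : PeriodSymbol) (1 : ℂ) +
      Finsupp.single (⟨curve L, hE, ω, hω, segPath hba hb ha⟩ : PeriodSymbol) 1) := by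
  obtain ⟨ρ₁, ρ₂, h₁, h₂, he⟩ := exists_isElementaryRelation_add_reverse hE ω hω (segPath hab ha hb)
    (segPath hba hb ha) (fun t _ => by
      simp only [segPath_toFun]
      congr 1
      push_cast
      ring)
  rw [he]
  exact span_add (span_of_rel h₁) (span_of_rel h₂)

/-- **`[a, c] ∼ [a, b] + [b, c]`** whenever the closed triangle `abc` avoids `Λ`, in the span format:
`(φ∘[a,c]) − (φ∘[a,b]) − (φ∘[b,c])` lies in the span of the elementary relations. [folklore] -/
theorem span_seg_sub_seg_sub_seg (hE : (curve L).IsSmoothAffineCurve)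
    (ω : Fin 2 → MvPolynomial (Fin 2) ℂ) (hω : ∀ k, HasAlgCoeffs (ω k)) {a b c : ℂ}
    (hab : ∀ t ∈ Icc (0 : ℝ) 1, a + t * (b - a) ∉ L.lattice)
    (hbc : ∀ t ∈ Icc (0 : ℝ) 1, b + t * (c - b) ∉ L.lattice)
    (hac : ∀ t ∈ Icc (0 : ℝ) 1, a + t * (c - a) ∉ L.lattice)
    (ha : IsAlgPt L a) (hb : IsAlgPt L b) (hc : IsAlgPt L c)
    (habc : ∀ p ∈ stdTriangle, a + p.1 * (b - a) + p.2 * (c - a) ∉ L.lattice) :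
    InSpan (Finsupp.single (⟨curve L, hE, ω, hω, segPath hac ha hc⟩ : PeriodSymbol) (1 : ℂ) -
      Finsupp.single (⟨curve L, hE, ω, hω, segPath hab ha hb⟩ : PeriodSymbol) 1 -
      Finsupp.single (⟨curve L, hE, ω, hω, segPath hbc hb hc⟩ : PeriodSymbol) 1) := by
  have h := span_smul (isAlgebraic_one.neg)
    (span_of_rel (isElementaryRelation_triangle hE ω hω hab hbc hac ha hb hc habc))
  obtain ⟨k, ρ, cf, hρ, hcf, hsum⟩ := h
  refine ⟨k, ρ, cf, hρ, hcf, ?_⟩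
  rw [← hsum]
  simp only [neg_smul, one_smul, neg_sub]
  abel

/-! ### Points of the segment and of the triangle, in lattice coordinates -/

/-- A closed segment avoids `Λ` as soon as its points have a non-integral `ω₂`-coordinate:
if `a = u ω₁ + v ω₂`, `b = u′ ω₁ + v ω₂` (same `v ∉ ℤ`... ) — elementary criterion used by the grid
files: the points `x ω₁ + y ω₂` with `y ∉ ℤ` are not in `Λ`. [folklore] -/
theorem notMem_lattice_of_snd_notInt {x y : ℝ} (hy : ∀ n : ℤ, y ≠ n) :
    (x : ℂ) * L.ω₁ + (y : ℂ) * L.ω₂ ∉ L.lattice := by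
  intro h
  rw [PeriodPair.mem_lattice] at h
  obtain ⟨m, n, hmn⟩ := h
  have hli := L.indep
  have e : ((x - m : ℝ) : ℂ) * L.ω₁ + ((y - n : ℝ) : ℂ) * L.ω₂ = 0 := by
    push_cast
    linear_combination -hmn
  have h2 := (LinearIndependent.pair_iff.mp hli) (x - m) (y - n) (by
    simpa only [real_smul] using e)
  exact hy n (by linarith [h2.2])

/-- Symmetrically in the first coordinate. [folklore] -/
theorem notMem_lattice_of_fst_notInt {x y : ℝ} (hx : ∀ n : ℤ, x ≠ n) :
    (x : ℂ) * L.ω₁ + (y : ℂ) * L.ω₂ ∉ L.lattice := by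
  intro h
  rw [PeriodPair.mem_lattice] at h
  obtain ⟨m, n, hmn⟩ := h
  have hli := L.indep
  have e : ((x - m : ℝ) : ℂ) * L.ω₁ + ((y - n : ℝ) : ℂ) * L.ω₂ = 0 := by
    push_cast
    linear_combination -hmn
  have h2 := (LinearIndependent.pair_iff.mp hli) (x - m) (y - n) (by
    simpa only [real_smul] using e)
  exact hx m (by linarith [h2.1])

end Ell

end CurvePeriods

end Literature.NumberTheory.Transcendental

end
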